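import Literature.MathematicalPhysics.QuantumFieldTheory.Balaban1983to89.B9Cor36BondSandwichTransfer
import Literature.MathematicalPhysics.QuantumFieldTheory.Balaban1983to89.B9Cor36SiteSandwichTransferBlocks

/-!
# `Balaban1983to89.B9Cor36BondSandwichTransferBlocks` — [Balaban1985BackgroundPropagators] COROLLARY 3.6 p. 408 ∕ THEOREM 3.3 p. 399 BOOKKEEPING, BOND SECTOR,
# ALL-BLOCKS READING: a [4]-(2.51) block majorant of a BOND-SECTOR operator over the CUBE SEQUENCE's blocks, sandwiched between a bi-contractive gauge rotation
# `R(u)⁻¹ … R(u)` (read at `b₋`) and two scalar cut-offs `M_{g₁} … M_{g₂}` (read at `b₋`, the right one supported near □), IS a block majorant over ALL THE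
# MEMBER's BLOCKS `𝔅` — the all-blocks geometry `geoBK i` keyed by the block `y(b₋) = blkV1 b` of the bond's initial point, with the same rate; NO section of the
# carrier-index map `β` (the section-free twin of lit-balaban-p38's `B9Cor36BondSandwichTransfer`, bond companion of dag-n06-c's `B9Cor36SiteSandwichTransferBlocks`)

T. Bałaban, *Propagators for lattice gauge theories in a background field*, Commun. Math. Phys. **99** (1985) 389–434 [`Balaban1985BackgroundPropagators`, "B9"]
(held `paper:balaban1985-cmp99-background-propagators`; journal page = PDF page + 388; page owner r06); [4] = T. Bałaban, *Propagators and renormalization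
transformations for lattice gauge theories. II*, Commun. Math. Phys. **96** (1984) 223–250 [`Balaban1984PropagatorsII`].

statement-level skeleton of published theorems with citation tags; proofs where landed; nothing here is a claim about the Yang–Mills mass gap

THE PRINTED LOCI.  [B9] Cor. 3.6 p. 408 (AS PRINTED: *«Corollary 3.6. If a configuration U satisfies (3.35) with O(1)Mα₀ ≦ α₁, and Ω′₀ ⊂ □̃ for a cube □ of the class
described in this condition, then Theorems 3.1–3.3 hold for the operators G′(U), (Q′(U)G′²(U)Q′*(U))⁻¹, G(U) constructed for the sequence {Ω′_j}. This follows from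
Corollary 3.5 applied to the configuration U′ = U^u, and we have to recall only that all the results of these theorems are gauge invariant.»*); (3.89) p. 409
(«for x ∈ Δ(y), supp λ ⊂ Δ(y′), y, y′ ∈ □» — read in the MEMBER's blocks); (3.28)–(3.33) pp. 395–396 (`R(u)` and the covariance of the letters); Thm 3.3 p. 399 («with
λ replaced by a function J defined at bonds»); (3.42) p. 397 («y, y′ ∈ 𝔅»); p. 393 l. 12–18 («Ω_j∖Ω_{j+1} = Bʲ(Λ_j)»).  [4] (2.51)–(2.55) p. 232, (2.45)–(2.46) p. 231,
p. 224 ∕ p. 248 (a bond belongs to the block of its initial point; «sites replaced by bonds»).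

WHY THIS FILE (pub-ymgap node N06 [B9], rows 19 of the N06 certificate; LOCATED-28; dag-lead WORDS 317 (2)(i)).  Lit-balaban-p38's `B9Cor36BondSandwichTransfer`
transfers a cube-side bond majorant (over `(toB6 (geoCK i □), blkBK i □)`) to node00-def-Y's INDEX-keyed member geometry `(toB6 (geo9K i), (f, j) ↦ ιB(Δ(f₋)))` through
a SECTION `ιB` of `β` — absent at the cornered members (`Node00.MemberYCornered`).  The all-members rows-19 supply of the N06 certificate reads the (3.42) bond block
majorants over the ALL-BLOCKS geometry `geoBK i` keyed by `y(b₋) = blkV1 i.hN i.D b` (dag-n06-c `B9Local342GOfBlocksXBK` ∕ `B9BlockKeyTransferXBK` consume exactly this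
key).  THIS FILE is p38's file in that key; the proof is p38's VERBATIM with the section deleted (the active source block near □ IS a cube block —
`blkCubeY_eq_of_blkOf_eq_of_nearH` applied to `Δ(f₋) = y′ = Δ(f₀₋)` directly; the coarsening comparisons are dag-n06-c's section-free `len_cube_le_len_block` ∕
`dist_block_le_dist_cube`):
* §1 ★★★ `hasMajorant_conj_bond_sandwich_blocks` — GENERIC: `conj b M ≺ K_C` over `(toB6 (geoCK i □), blkBK i □)`, `|g₁(f)| ≤ G₁(Δ_□(f₋))`, `|g₂(f)| ≤ G₂(Δ_□(f₋))` with
  `g₂(f) ≠ 0 ⟹ f₋` near □, `γ` bi-contractive, `K ≥ 0` on blocks with `G₁(Δ_□f)·K_C(Δ_□f, Δ_□f₀)·G₂(Δ_□f₀) ≤ K(Δ(f₋), Δ(f₀₋))` at active sources ⟹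
  `conj b(M_{g₁}R(γ)⁻¹MR(γ)M_{g₂}) ≺ (M₂Σ_j‖b_j‖)²·K` over `(toB6 (geoBK i), (f, j) ↦ Δ(f₋))`;
* §2 ★★ `hasMajorant_conj_bond_sandwich_decay_blocks`, ★★ `hasMajorant_conj_bond_sandwich_decay_src_blocks` — the two shapes of record.

HONEST SCOPE ∕ NOT CLAIMED.  Finite bookkeeping; NO estimate of [B9] is proved (the cube-side majorant `hM` is a HYPOTHESIS — lit-balaban G-F6a `B9Cor36GCubeEntriesAtV`
supplies it).  «Cornered members» are OUR bookkeeping ([B7] (4) p. 18 ∕ [B9] p. 393 assume complete blocks; lit-balaban OWNER WORD IR-N06-SECTION 2026-08-30: consumer-side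
object).  Inhabited as p38's (`g₂ := 0`).  Count-neutral; rows 19 NOT thereby derived; N06 NOT discharged; nothing on `d = 4`, the continuum, reflection positivity,
the mass gap or Clay.  No `sorry`, no `axiom`, no `… : Prop` fact, no `instance`, no `notation`, no `def`.  NEW file; nothing landed is modified.  Cell `pub-ymgap`
(D-0062), seat `pub-ymgap-dag-n06-c` (gen 23), 2026-08-30; `--supports stmt-QuantumFields-27364`.  Net new unproved facts: 0.

RELATED IN THE TREE, NOT DUPLICATED (searched 2026-08-30: `rg` for the basename and the three decl names over `lean/Literature` + `lean/Summits` — 0 hits): p38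
`B9Cor36BondSandwichTransfer` (index-keyed through `ιB`), p33 `B9Cor36SiteSandwichTransfer` (`blkCubeY_eq_of_blkOf_eq_of_nearH`, `norm_le_sum_mul_of_repr_le` lineage BY
NAME), dag-n06-c `B9Cor36SiteSandwichTransferBlocks` (site twin; §1 comparisons BY NAME).
-/

noncomputable section

namespace Literature.MathematicalPhysics.QuantumFieldTheory.Balaban1983to89.B9Cor36BondSandwichTransferBlocks

open B6RandomWalk (HasMajorant BlockSupp hasMajorant_mono)
open B9Thm34Ext (toB6)
open B9Ineq347 (ScaleTransfer)
open B9Eq39Adjoint (R R_zero R_smul)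
open B9Eq352DivFormLetters (conj conj_apply coordEquiv coordEquiv_apply coordEquiv_symm_apply norm_coordSymm_apply_le)
open B6KLevelCensusIndexV1 (KIdx kGeo)
open B6Cover236MultiLevelBlocks (cubes)
open B6Geom246MultiLevelBox (bset blkOf)
open B6GlobalChartV1 (blkV1)
open B9CubeSequence408 (NearH)
open B9CubeLettersOpsL0 (cubeFamY)
open B9CubeLettersBondOpsL0 (BlkCubeY)
open B9Eq360DeltaPrimeACubeY (blkCubeY)
open B9CubeGeometryInputs (geoCK geoCK_len_pos geoCK_dist_axioms)
open B9Thm37CubeCoverCommutators (cutMulY cutMulY_apply)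
open B9Cor36CinvCubeLocLetterMajorant (norm_le_sum_mul_of_repr_le)
open B9Cor36SiteSandwichTransfer (blkCubeY_eq_of_blkOf_eq_of_nearH)
open B9Cor36SiteSandwichTransferBlocks (len_cube_le_len_block dist_block_le_dist_cube)
open B9SectBAllBlocksGeometryY (geoBK geoBK_len_pos)
open B9Cor35GCubeInputsAtOne (blkBK)
open Node00 (SiteY BlkY FBondY conjY conjY_apply toKT)
open Node00.OpsYNablaBridge (chartY)

variable {d ℓ : ℕ} {hd : 1 ≤ d + 1} {hL : Odd (ℓ + 1) ∧ 1 < ℓ + 1} {b₀ b₁ : ℝ}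
variable {𝔸 : Type} [NormedRing 𝔸] [NormedAlgebra ℂ 𝔸] [CompleteSpace 𝔸]
variable {ι : Type} [Fintype ι]

/-! ## §1  ★★★ The bond-sector sandwich transfer: cube-sequence blocks → ALL the member's blocks, keyed by `y(b₋)` (no section) -/

section Transfer

variable (i : KIdx d ℓ hd hL b₀ b₁) (c : ↥(cubes (toKT i).D.toDomains)) (b : Module.Basis ι ℝ 𝔸)

omit [CompleteSpace 𝔸] in
/-- ★★★ **THE BOND-SECTOR SANDWICH TRANSFER, ALL-BLOCKS KEY (section-free twin of p33's `hasMajorant_conj_bond_sandwich`).**  Let `M` be an `ℝ`-linear operator on the `𝔸`-valued bond functions whose coordinate conjugate has the block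
majorant `K_C` over the cube sequence's geometry `(toB6 (geoCK i □), blkBK i □)`; let `γ` be a bi-contractive field of units on the bonds (the gauge `u`
read at `b₋`), `g₁, g₂` real multipliers on bonds with `|g₁(f)| ≤ G₁(Δ_□(f₋))`, `|g₂(f)| ≤ G₂(Δ_□(f₋))` and `g₂` supported on bonds with initial point
near □; let `K ≥ 0` be a kernel on the member's BLOCKS dominating `G₁(Δ_□f)·K_C(Δ_□f, Δ_□f₀)·G₂(Δ_□f₀)` for every row bond `f` and every active
source bond `f₀`.  Then over the all-blocks geometry `(toB6 (geoBK i), (f, j) ↦ Δ(f₋))`: `conj b (M_{g₁}·R(γ)⁻¹·M·R(γ)·M_{g₂}) ≺ (M₂Σ_j‖b_j‖)²·K`.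
[cite: Balaban1985BackgroundPropagators, Cor. 3.6 p.408 l.1–14, (3.89) p.409, (3.28)–(3.33) pp.395–396, Thm 3.3 p.399; Balaban1984PropagatorsII, (2.51)–(2.55) p.232, (2.45)–(2.46) p.231, p.224] -/
theorem hasMajorant_conj_bond_sandwich_blocks {M₂ : ℝ} (hM₂ : 0 ≤ M₂) (hrepr : ∀ (v : 𝔸) (j : ι), |b.repr v j| ≤ M₂ * ‖v‖)
    (γ : FBondY i → 𝔸ˣ) (hγ : ∀ f a, ‖R (γ f) a‖ ≤ ‖a‖ ∧ ‖R (γ f)⁻¹ a‖ ≤ ‖a‖)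
    (g₁ g₂ : FBondY i → ℝ) (G₁ G₂ : BlkCubeY i c → ℝ) (hG₁ : ∀ f, |g₁ f| ≤ G₁ (blkCubeY i c (chartY i f.src)))
    (hG₂ : ∀ f, |g₂ f| ≤ G₂ (blkCubeY i c (chartY i f.src)))
    (hnear : ∀ f, g₂ f ≠ 0 → NearH c (chartY i f.src).1)
    (Rr : ℝ) (H : Prop) [Fintype (geoBK i).Site] (Rr' : ℝ) (Hp : Prop)
    {KC : BlkCubeY i c → BlkCubeY i c → ℝ} {K : (geoBK i).Site → (geoBK i).Site → ℝ} (hK : ∀ a a', 0 ≤ K a a')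
    (hcmp : ∀ x x₀ : FBondY i, g₂ x₀ ≠ 0 →
      G₁ (blkCubeY i c (chartY i x.src)) * KC (blkCubeY i c (chartY i x.src)) (blkCubeY i c (chartY i x₀.src)) * G₂ (blkCubeY i c (chartY i x₀.src)) ≤
        K (blkOf i.D.toDomains (chartY i x.src)) (blkOf i.D.toDomains (chartY i x₀.src)))
    (M : Module.End ℝ (FBondY i → 𝔸)) (hM : HasMajorant (g := toB6 (geoCK i c) Rr H) (blkBK i c) (conj b M) KC) :
    HasMajorant (g := toB6 (geoBK i) Rr' Hp) (fun p : FBondY i × ι => blkV1 i.hN i.D p.1)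
      (conj b ((cutMulY (𝔸 := 𝔸) g₁).restrictScalars ℝ ∘ₗ (conjY γ⁻¹).restrictScalars ℝ ∘ₗ M ∘ₗ (conjY γ).restrictScalars ℝ ∘ₗ
        (cutMulY (𝔸 := 𝔸) g₂).restrictScalars ℝ))
      (fun a a' => (M₂ * ∑ j, ‖b j‖) ^ 2 * K a a') := by
  intro y' μ B hμ x
  have hSb : 0 ≤ ∑ j, ‖b j‖ := Finset.sum_nonneg fun _ _ => norm_nonneg _
  have hKB : 0 ≤ (M₂ * ∑ j, ‖b j‖) ^ 2 * K (blkV1 i.hN i.D x.1) y' * B := mul_nonneg (mul_nonneg (sq_nonneg _) (hK _ _)) hμ.nonneg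
  -- the source as an `𝔸`-valued bond function, cut and rotated
  set lam : FBondY i → 𝔸 := (coordEquiv b).symm μ with hlam
  set ν : FBondY i → 𝔸 := conjY γ (cutMulY g₂ lam) with hν
  rw [conj_apply]
  simp only [LinearMap.comp_apply, LinearMap.restrictScalars_apply]
  rw [← hlam]
  change |b.repr (cutMulY g₁ (conjY γ⁻¹ (M ν)) x.1) x.2| ≤ (M₂ * ∑ j, ‖b j‖) ^ 2 * K (blkV1 i.hN i.D x.1) y' * B
  rw [cutMulY_apply, conjY_apply, Pi.inv_apply]
  -- the row factor: `|repr (g₁(x)·R(γ(x))⁻¹ a)| ≤ M₂·|g₁ x|·‖a‖`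
  have hrowfac : |b.repr ((((g₁ x.1 : ℝ) : ℂ)) • R (γ x.1)⁻¹ (M ν x.1)) x.2| ≤ M₂ * (G₁ (blkCubeY i c (chartY i x.1.src)) * ‖M ν x.1‖) := by
    refine (hrepr _ _).trans (mul_le_mul_of_nonneg_left ?_ hM₂)
    rw [norm_smul, Complex.norm_real, Real.norm_eq_abs]
    exact mul_le_mul (hG₁ x.1) ((hγ x.1 _).2) (norm_nonneg _) ((abs_nonneg _).trans (hG₁ x.1))
  -- the source: every value of `lam` is bounded by `(Σ‖b‖)·B`, and `lam` vanishes off the member block over `y′`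
  have hlam_bd : ∀ w, ‖lam w‖ ≤ (∑ j, ‖b j‖) * B := fun w => by
    by_cases hw : blkV1 i.hN i.D w = y'
    · rw [hlam]; exact norm_coordSymm_apply_le b μ w B fun j => hμ.bound (w, j) hw
    · have h0 : lam w = 0 := by
        rw [hlam, coordEquiv_symm_apply]
        exact Finset.sum_eq_zero fun j _ => by rw [hμ.off (w, j) hw, zero_smul]
      rw [h0, norm_zero]; exact mul_nonneg hSb hμ.nonneg
  have hlam_off : ∀ w, blkV1 i.hN i.D w ≠ y' → lam w = 0 := fun w hw => by
    rw [hlam, coordEquiv_symm_apply]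
    exact Finset.sum_eq_zero fun j _ => by rw [hμ.off (w, j) hw, zero_smul]
  have hν_val : ∀ w, ν w = R (γ w) ((((g₂ w : ℝ) : ℂ)) • lam w) := fun w => by rw [hν, conjY_apply, cutMulY_apply]
  -- either `ν = 0`, or there is an active source bond `w₀` (then its initial point is near □, and it lies in the member block over `y′`)
  by_cases hex : ∃ w₀, g₂ w₀ ≠ 0 ∧ lam w₀ ≠ 0
  swap
  · have hν0 : ν = 0 := funext fun w => by
      rw [hν_val]
      by_cases h2 : g₂ w = 0
      · rw [h2, Complex.ofReal_zero, zero_smul, R_zero]; rfl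
      · have hl : lam w = 0 := by
          by_contra hl; exact hex ⟨w, h2, hl⟩
        rw [hl, smul_zero, R_zero]; rfl
    rw [hν0, map_zero, Pi.zero_apply, R_zero, smul_zero, map_zero, Finsupp.zero_apply, abs_zero]
    exact hKB
  obtain ⟨w₀, hg₂w₀, hlamw₀⟩ := hex
  have hy' : blkV1 i.hN i.D w₀ = y' := by
    by_contra h; exact hlamw₀ (hlam_off w₀ h)
  have hw₀near : NearH c (chartY i w₀.src).1 := hnear w₀ hg₂w₀
  set s₀ : BlkCubeY i c := blkCubeY i c (chartY i w₀.src) with hs₀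
  have hG₂0 : 0 ≤ G₂ s₀ := (abs_nonneg _).trans (hG₂ w₀)
  -- bonds carrying the source have their initial point in the cube block `s₀`
  have hblk : ∀ w, lam w ≠ 0 → blkCubeY i c (chartY i w.src) = s₀ := fun w hw => by
    have h1 : blkV1 i.hN i.D w = y' := by
      by_contra h; exact hw (hlam_off w h)
    have h2 : blkOf i.D.toDomains (chartY i w.src) = blkOf i.D.toDomains (chartY i w₀.src) := h1.trans hy'.symm
    exact blkCubeY_eq_of_blkOf_eq_of_nearH i c hw₀near h2
  -- the coordinates of `ν`: a source over the cube geometry supported in `s₀`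
  have hνsupp : BlockSupp (g := toB6 (geoCK i c) Rr H) (blkBK i c) (coordEquiv b ν) s₀ (M₂ * (G₂ s₀ * ((∑ j, ‖b j‖) * B))) := by
    refine ⟨mul_nonneg hM₂ (mul_nonneg hG₂0 (mul_nonneg hSb hμ.nonneg)), fun p hp => ?_, fun p hp => ?_⟩
    · rw [coordEquiv_apply]
      refine (hrepr _ _).trans (mul_le_mul_of_nonneg_left ?_ hM₂)
      rw [hν_val]
      refine ((hγ p.1 _).1).trans ?_
      rw [norm_smul, Complex.norm_real, Real.norm_eq_abs]
      have hp' : blkCubeY i c (chartY i p.1.src) = s₀ := hp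
      exact mul_le_mul ((hG₂ p.1).trans (by rw [hp'])) (hlam_bd p.1) (norm_nonneg _) hG₂0
    · rw [coordEquiv_apply]
      have hl : lam p.1 = 0 := by
        by_contra hl; exact hp (hblk p.1 hl)
      rw [hν_val, hl, smul_zero, R_zero, map_zero, Finsupp.zero_apply]
  -- the cube-side majorant on that source, read at the rows `(x.1, j′)`
  have hrow : ∀ j', |b.repr (M ν x.1) j'| ≤ KC (blkCubeY i c (chartY i x.1.src)) s₀ * (M₂ * (G₂ s₀ * ((∑ j, ‖b j‖) * B))) := fun j' => by
    have h := hM s₀ (coordEquiv b ν) _ hνsupp (x.1, j')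
    rwa [conj_apply, LinearEquiv.symm_apply_apply] at h
  have hnorm : ‖M ν x.1‖ ≤ (∑ j, ‖b j‖) * (KC (blkCubeY i c (chartY i x.1.src)) s₀ * (M₂ * (G₂ s₀ * ((∑ j, ‖b j‖) * B)))) :=
    norm_le_sum_mul_of_repr_le b _ hrow
  have hc : G₁ (blkCubeY i c (chartY i x.1.src)) * KC (blkCubeY i c (chartY i x.1.src)) (blkCubeY i c (chartY i w₀.src)) *
      G₂ (blkCubeY i c (chartY i w₀.src)) ≤ K (blkV1 i.hN i.D x.1) y' := by
    rw [← hy']; exact hcmp x.1 w₀ hg₂w₀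
  have hG₁0 : 0 ≤ G₁ (blkCubeY i c (chartY i x.1.src)) := (abs_nonneg _).trans (hG₁ x.1)
  calc |b.repr ((((g₁ x.1 : ℝ) : ℂ)) • R (γ x.1)⁻¹ (M ν x.1)) x.2| ≤ M₂ * (G₁ (blkCubeY i c (chartY i x.1.src)) * ‖M ν x.1‖) := hrowfac
    _ ≤ M₂ * (G₁ (blkCubeY i c (chartY i x.1.src)) * ((∑ j, ‖b j‖) * (KC (blkCubeY i c (chartY i x.1.src)) s₀ * (M₂ * (G₂ s₀ * ((∑ j, ‖b j‖) * B)))))) :=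
        mul_le_mul_of_nonneg_left (mul_le_mul_of_nonneg_left hnorm hG₁0) hM₂
    _ = (M₂ * ∑ j, ‖b j‖) ^ 2 * (G₁ (blkCubeY i c (chartY i x.1.src)) * KC (blkCubeY i c (chartY i x.1.src)) (blkCubeY i c (chartY i w₀.src)) *
          G₂ (blkCubeY i c (chartY i w₀.src))) * B := by
        rw [hs₀]; ring
    _ ≤ (M₂ * ∑ j, ‖b j‖) ^ 2 * K (blkV1 i.hN i.D x.1) y' * B :=
        mul_le_mul_of_nonneg_right (mul_le_mul_of_nonneg_left hc (sq_nonneg _)) hμ.nonneg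

end Transfer

/-! ## §2  The shapes of record: decaying cube-side kernels with length weights, all-blocks key -/

section Decay

variable (i : KIdx d ℓ hd hL b₀ b₁) (c : ↥(cubes (toKT i).D.toDomains)) (b : Module.Basis ι ℝ 𝔸)

omit [CompleteSpace 𝔸] in
/-- ★★ **THE BOND SANDWICH TRANSFER FOR `K_C = B·ℓ_□(a)ⁿ·e^{−δd_□(a,a′)}`, ROW MULTIPLIER `|g₁| ≤ c₁·ℓ_□⁻ᵐ` (`m ≤ n`), CUT-OFF `|g₂| ≤ c₂` NEAR □, ALL-BLOCKS KEY**: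
`conj b (M_{g₁}R(γ)⁻¹MR(γ)M_{g₂}) ≺ (M₂Σ‖b‖)²c₁c₂B·ℓ(a)^{n−m}·e^{−δd(a,a′)}` over the all-blocks geometry keyed by `y(b₋)` — levels only grow and distances only shrink under
coarsening (r05's p. 409 reading); section-free twin of p33's `…_decay`. [cite: Balaban1985BackgroundPropagators, Cor. 3.6 p.408, (3.89) p.409, Thm 3.3 (3.42) p.397∕399; Balaban1984PropagatorsII, (2.51) p.232, (2.46) p.231] -/
theorem hasMajorant_conj_bond_sandwich_decay_blocks {M₂ : ℝ} (hM₂ : 0 ≤ M₂) (hrepr : ∀ (v : 𝔸) (j : ι), |b.repr v j| ≤ M₂ * ‖v‖)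
    (γ : FBondY i → 𝔸ˣ) (hγ : ∀ f a, ‖R (γ f) a‖ ≤ ‖a‖ ∧ ‖R (γ f)⁻¹ a‖ ≤ ‖a‖)
    (g₁ g₂ : FBondY i → ℝ) {c₁ c₂ : ℝ} (hc₁ : 0 ≤ c₁) (hc₂ : 0 ≤ c₂) {m n : ℕ} (hmn : m ≤ n)
    (hg₁ : ∀ f, |g₁ f| * (geoCK i c).len (blkCubeY i c (chartY i f.src)) ^ m ≤ c₁) (hg₂ : ∀ f, |g₂ f| ≤ c₂)
    (hnear : ∀ f, g₂ f ≠ 0 → NearH c (chartY i f.src).1)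
    (Rr : ℝ) (H : Prop) [Fintype (geoBK i).Site] (Rr' : ℝ) (Hp : Prop)
    {B δ : ℝ} (hB : 0 ≤ B) (hδ : 0 ≤ δ) (M : Module.End ℝ (FBondY i → 𝔸))
    (hM : HasMajorant (g := toB6 (geoCK i c) Rr H) (blkBK i c) (conj b M) (fun a a' => B * (geoCK i c).len a ^ n * Real.exp (-(δ * (geoCK i c).dist a a')))) :
    HasMajorant (g := toB6 (geoBK i) Rr' Hp) (fun p : FBondY i × ι => blkV1 i.hN i.D p.1)
      (conj b ((cutMulY (𝔸 := 𝔸) g₁).restrictScalars ℝ ∘ₗ (conjY γ⁻¹).restrictScalars ℝ ∘ₗ M ∘ₗ (conjY γ).restrictScalars ℝ ∘ₗ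
        (cutMulY (𝔸 := 𝔸) g₂).restrictScalars ℝ))
      (fun a a' => (M₂ * ∑ j, ‖b j‖) ^ 2 * (c₁ * c₂ * B) * (geoBK i).len a ^ (n - m) * Real.exp (-(δ * (geoBK i).dist a a'))) := by
  have hlenpos : ∀ f : FBondY i, 0 < (geoCK i c).len (blkCubeY i c (chartY i f.src)) := fun f => geoCK_len_pos i c _
  refine hasMajorant_mono (g := toB6 (geoBK i) Rr' Hp) _
    (hasMajorant_conj_bond_sandwich_blocks i c b hM₂ hrepr γ hγ g₁ g₂ (fun s => c₁ * ((geoCK i c).len s ^ m)⁻¹) (fun _ => c₂)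
      (fun f => ?_) hg₂ hnear Rr H Rr' Hp (K := fun a a' => (c₁ * c₂ * B) * (geoBK i).len a ^ (n - m) * Real.exp (-(δ * (geoBK i).dist a a')))
      (fun a a' => ?_) (fun x x₀ _ => ?_) M hM)
    fun a a' => le_of_eq (by ring)
  · have hp := pow_pos (hlenpos f) m
    rw [← div_eq_mul_inv, le_div_iff₀ hp]
    exact hg₁ f
  · exact mul_nonneg (mul_nonneg (mul_nonneg (mul_nonneg hc₁ hc₂) hB) (pow_nonneg (geoBK_len_pos i a).le _)) (Real.exp_nonneg _)
  · have hlx := hlenpos x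
    have hLC := len_cube_le_len_block i c (chartY i x.src)
    have hdD := dist_block_le_dist_cube i c (chartY i x.src) (chartY i x₀.src)
    have hpow : (geoCK i c).len (blkCubeY i c (chartY i x.src)) ^ n * ((geoCK i c).len (blkCubeY i c (chartY i x.src)) ^ m)⁻¹ =
        (geoCK i c).len (blkCubeY i c (chartY i x.src)) ^ (n - m) := by
      rw [pow_sub₀ _ hlx.ne' hmn]
    have hexp : Real.exp (-(δ * (geoCK i c).dist (blkCubeY i c (chartY i x.src)) (blkCubeY i c (chartY i x₀.src)))) ≤
        Real.exp (-(δ * (geoBK i).dist (blkOf i.D.toDomains (chartY i x.src)) (blkOf i.D.toDomains (chartY i x₀.src)))) :=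
      Real.exp_le_exp.2 (by nlinarith)
    have hpw : (geoCK i c).len (blkCubeY i c (chartY i x.src)) ^ (n - m) ≤ (geoBK i).len (blkOf i.D.toDomains (chartY i x.src)) ^ (n - m) :=
      pow_le_pow_left₀ hlx.le hLC _
    calc c₁ * ((geoCK i c).len (blkCubeY i c (chartY i x.src)) ^ m)⁻¹ * (B * (geoCK i c).len (blkCubeY i c (chartY i x.src)) ^ n *
          Real.exp (-(δ * (geoCK i c).dist (blkCubeY i c (chartY i x.src)) (blkCubeY i c (chartY i x₀.src))))) * c₂
        = (c₁ * c₂ * B) * ((geoCK i c).len (blkCubeY i c (chartY i x.src)) ^ n * ((geoCK i c).len (blkCubeY i c (chartY i x.src)) ^ m)⁻¹) *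
          Real.exp (-(δ * (geoCK i c).dist (blkCubeY i c (chartY i x.src)) (blkCubeY i c (chartY i x₀.src)))) := by ring
      _ = (c₁ * c₂ * B) * (geoCK i c).len (blkCubeY i c (chartY i x.src)) ^ (n - m) *
          Real.exp (-(δ * (geoCK i c).dist (blkCubeY i c (chartY i x.src)) (blkCubeY i c (chartY i x₀.src)))) := by rw [hpow]
      _ ≤ (c₁ * c₂ * B) * (geoBK i).len (blkOf i.D.toDomains (chartY i x.src)) ^ (n - m) *
          Real.exp (-(δ * (geoBK i).dist (blkOf i.D.toDomains (chartY i x.src)) (blkOf i.D.toDomains (chartY i x₀.src)))) :=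
          mul_le_mul (mul_le_mul_of_nonneg_left hpw (mul_nonneg (mul_nonneg hc₁ hc₂) hB)) hexp (Real.exp_nonneg _)
            (mul_nonneg (mul_nonneg (mul_nonneg hc₁ hc₂) hB) (pow_nonneg (geoBK_len_pos i _).le _))

omit [CompleteSpace 𝔸] in
/-- ★★ **THE SOURCE-WEIGHTED VARIANT, ALL-BLOCKS KEY** (the right cut-off derivative of (3.42)₃; section-free twin of p33's `…_decay_src`): `K_C = B·ℓ_□(a)²·e^{−δd_□}`, `|g₁| ≤ c₁`, `|g₂| ≤ c₂·ℓ_□⁻¹` near □, and ONE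
scale transfer of the cube geometry `e^{−αδd_□(a,a′)}ℓ_□(a′)⁻¹ ≤ Λ·ℓ_□(a)⁻¹` (p. 398 remark; p33's `hST_geoCK`, third component) ⟹
`≺ (M₂Σ‖b‖)²c₁c₂BΛ·ℓ(a)·e^{−(1−α)δd(a,a′)}` over the all-blocks geometry keyed by `y(b₋)`.
[cite: Balaban1985BackgroundPropagators, Cor. 3.6 p.408, Thm 3.1 (3.42)₃ p.397, p.398 (remark after (3.47)); Balaban1984PropagatorsII, (2.51) p.232, (2.46) p.231] -/
theorem hasMajorant_conj_bond_sandwich_decay_src_blocks {M₂ : ℝ} (hM₂ : 0 ≤ M₂) (hrepr : ∀ (v : 𝔸) (j : ι), |b.repr v j| ≤ M₂ * ‖v‖)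
    (γ : FBondY i → 𝔸ˣ) (hγ : ∀ f a, ‖R (γ f) a‖ ≤ ‖a‖ ∧ ‖R (γ f)⁻¹ a‖ ≤ ‖a‖)
    (g₁ g₂ : FBondY i → ℝ) {c₁ c₂ : ℝ} (hc₁ : 0 ≤ c₁) (hc₂ : 0 ≤ c₂)
    (hg₁ : ∀ f, |g₁ f| ≤ c₁) (hg₂ : ∀ f, |g₂ f| * (geoCK i c).len (blkCubeY i c (chartY i f.src)) ≤ c₂) (hnear : ∀ f, g₂ f ≠ 0 → NearH c (chartY i f.src).1)
    (Rr : ℝ) (H : Prop) [Fintype (geoBK i).Site] (Rr' : ℝ) (Hp : Prop)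
    {B δ α Λ : ℝ} (hB : 0 ≤ B) (hδ : 0 ≤ δ) (hα1 : α ≤ 1) (hΛ : 0 ≤ Λ)
    (hST : ScaleTransfer (geoCK i c) δ α Λ (fun a => ((geoCK i c).len a)⁻¹))
    (M : Module.End ℝ (FBondY i → 𝔸))
    (hM : HasMajorant (g := toB6 (geoCK i c) Rr H) (blkBK i c) (conj b M) (fun a a' => B * (geoCK i c).len a ^ 2 * Real.exp (-(δ * (geoCK i c).dist a a')))) :
    HasMajorant (g := toB6 (geoBK i) Rr' Hp) (fun p : FBondY i × ι => blkV1 i.hN i.D p.1)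
      (conj b ((cutMulY (𝔸 := 𝔸) g₁).restrictScalars ℝ ∘ₗ (conjY γ⁻¹).restrictScalars ℝ ∘ₗ M ∘ₗ (conjY γ).restrictScalars ℝ ∘ₗ
        (cutMulY (𝔸 := 𝔸) g₂).restrictScalars ℝ))
      (fun a a' => (M₂ * ∑ j, ‖b j‖) ^ 2 * (c₁ * c₂ * B * Λ) * (geoBK i).len a * Real.exp (-((1 - α) * δ * (geoBK i).dist a a'))) := by
  have hlenpos : ∀ f : FBondY i, 0 < (geoCK i c).len (blkCubeY i c (chartY i f.src)) := fun f => geoCK_len_pos i c _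
  have hdnn := (geoCK_dist_axioms i c Rr H).1
  refine hasMajorant_mono (g := toB6 (geoBK i) Rr' Hp) _
    (hasMajorant_conj_bond_sandwich_blocks i c b hM₂ hrepr γ hγ g₁ g₂ (fun _ => c₁) (fun s => c₂ * ((geoCK i c).len s)⁻¹)
      hg₁ (fun f => ?_) hnear Rr H Rr' Hp
      (K := fun a a' => (c₁ * c₂ * B * Λ) * (geoBK i).len a * Real.exp (-((1 - α) * δ * (geoBK i).dist a a')))
      (fun a a' => ?_) (fun x x₀ _ => ?_) M hM)
    fun a a' => le_of_eq (by ring)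
  · rw [← div_eq_mul_inv, le_div_iff₀ (hlenpos f)]
    exact hg₂ f
  · exact mul_nonneg (mul_nonneg (mul_nonneg (mul_nonneg (mul_nonneg hc₁ hc₂) hB) hΛ) (geoBK_len_pos i a).le) (Real.exp_nonneg _)
  · have hlx := hlenpos x
    have hLC := len_cube_le_len_block i c (chartY i x.src)
    have hdD := dist_block_le_dist_cube i c (chartY i x.src) (chartY i x₀.src)
    set ax := blkCubeY i c (chartY i x.src) with hax
    set a0 := blkCubeY i c (chartY i x₀.src) with ha0
    set dC := (geoCK i c).dist ax a0 with hdC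
    have hT := hST ax a0
    have hsplit : Real.exp (-(δ * dC)) = Real.exp (-(α * δ * dC)) * Real.exp (-((1 - α) * δ * dC)) := by
      rw [← Real.exp_add]; ring_nf
    have hexp : Real.exp (-((1 - α) * δ * dC)) ≤
        Real.exp (-((1 - α) * δ * (geoBK i).dist (blkOf i.D.toDomains (chartY i x.src)) (blkOf i.D.toDomains (chartY i x₀.src)))) := by
      refine Real.exp_le_exp.2 ?_
      have h1 : 0 ≤ (1 - α) * δ := mul_nonneg (by linarith) hδ
      nlinarith
    have key : ((geoCK i c).len ax) ^ 2 * Real.exp (-(δ * dC)) * ((geoCK i c).len a0)⁻¹ ≤ Λ * (geoCK i c).len ax * Real.exp (-((1 - α) * δ * dC)) := by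
      rw [hsplit]
      have h2 : Real.exp (-(α * δ * dC)) * ((geoCK i c).len a0)⁻¹ ≤ Λ * ((geoCK i c).len ax)⁻¹ := hT
      have hl2 : 0 ≤ (geoCK i c).len ax ^ 2 * Real.exp (-((1 - α) * δ * dC)) := mul_nonneg (sq_nonneg _) (Real.exp_nonneg _)
      calc (geoCK i c).len ax ^ 2 * (Real.exp (-(α * δ * dC)) * Real.exp (-((1 - α) * δ * dC))) * ((geoCK i c).len a0)⁻¹
          = ((geoCK i c).len ax ^ 2 * Real.exp (-((1 - α) * δ * dC))) * (Real.exp (-(α * δ * dC)) * ((geoCK i c).len a0)⁻¹) := by ring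
        _ ≤ ((geoCK i c).len ax ^ 2 * Real.exp (-((1 - α) * δ * dC))) * (Λ * ((geoCK i c).len ax)⁻¹) := mul_le_mul_of_nonneg_left h2 hl2
        _ = Λ * (geoCK i c).len ax * Real.exp (-((1 - α) * δ * dC)) := by field_simp
    have hpre : 0 ≤ c₁ * c₂ * B := mul_nonneg (mul_nonneg hc₁ hc₂) hB
    calc c₁ * (B * (geoCK i c).len ax ^ 2 * Real.exp (-(δ * dC))) * (c₂ * ((geoCK i c).len a0)⁻¹)
        = (c₁ * c₂ * B) * ((geoCK i c).len ax ^ 2 * Real.exp (-(δ * dC)) * ((geoCK i c).len a0)⁻¹) := by ring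
      _ ≤ (c₁ * c₂ * B) * (Λ * (geoCK i c).len ax * Real.exp (-((1 - α) * δ * dC))) := mul_le_mul_of_nonneg_left key hpre
      _ = (c₁ * c₂ * B * Λ) * (geoCK i c).len ax * Real.exp (-((1 - α) * δ * dC)) := by ring
      _ ≤ (c₁ * c₂ * B * Λ) * (geoBK i).len (blkOf i.D.toDomains (chartY i x.src)) *
          Real.exp (-((1 - α) * δ * (geoBK i).dist (blkOf i.D.toDomains (chartY i x.src)) (blkOf i.D.toDomains (chartY i x₀.src)))) :=
          mul_le_mul (mul_le_mul_of_nonneg_left hLC (mul_nonneg hpre hΛ)) hexp (Real.exp_nonneg _)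
            (mul_nonneg (mul_nonneg hpre hΛ) (geoBK_len_pos i _).le)

end Decay

end Literature.MathematicalPhysics.QuantumFieldTheory.Balaban1983to89.B9Cor36BondSandwichTransferBlocks

end
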